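import Mathlib
import HarnessLib
import HarnessLib.Audit
import Summits.Langlands.Langlands.Theorems.ModuliFieldDescentSplitPrelude

/-!
# ModuliFieldDescentSplit — lens-5 g32 node on CORE = `OddPrimeDoorSplit.CoreResidual`

RESIDUAL MODE (cell decomp-langlands, LADDER-Langlands root decomposition D-0178), lineage of route-Langlands-TowerDoorSplit:
REST (stmt-Langlands-26998) → REST_E (g26 `DepthIsolationSplit`) → LJR (g27 `JDegreeFilterSplit`) → RES (g28 `DyadicDoorSplit`)
→ F2T ∧ … (g29 `TwoDivisionFieldSplit`) → CORE (g30 `OddPrimeDoorSplit`, landed p829144 / p829190) → CORE′ ∧ cells (g31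
`RealCyclotomicDoorSplit`, CLEARED row 463).  This node refines CORE (tree decl, BY NAME) along an axis that COMMUTES with g31's
field / level cells (pure conjunction of hypotheses).

AXIS (finite/base range + asymptotic regime + bridge, in the currency of the MODULI DEGREE `m = [ℚ(j(E)) : ℚ]`, pushed through
ALL degrees).  g27 cut the dial `jDeg` at `4` because modularity over the field of moduli `F = ℚ(j(E)) ≤ K₀` is printed only for
`[F:ℚ] ≤ 4`.  OBSERVATION (idempotence of the descent): the `F`-model `jModel p q` of `j(E) = p/q ∈ F` is j-PRIMITIVE over `F`
(`ℚ(j(jModel)) = F`), and `E` is a quadratic twist of its base change to `K₀` (twist invariance of modularity is the PROVED tree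
lemma `isModularEllipticCurve_of_jInvariant_eq_holds`; `j ∈ {0, 1728}` is CM, PROVED `WeierstrassCurve.HasCM.of_j_eq_zero_or_1728`).
Hence NO truncation and NO induction are needed: every core curve is accounted to exactly ONE j-primitive curve over a totally
real field of degree `m = jDeg ∣ [K₀:ℚ]`, and CORE splits as

* PRIM `PrimitiveCoreResidual` (asymptotic regime = the DECLARED RESIDUAL; WEAKER; IDEA-NEEDED): CORE on the pairs `(K₀, E)` with
  `ℚ(j(E)) = K₀` (`JPrimitive`: `[ℚ(j):ℚ] = [K₀:ℚ]`).  In moduli terms (on g31's CELL D): the closed points `x` of the four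
  level-`105` curves `X₀(105)`, `X(s3,b5,b7)`, `X(b3,b5,e7)`, `X(s3,b5,e7)` with `ℚ(x) = ℚ(j(x))` totally real, unanchored, of degree
  `≥ 6` — ONE parameter (a totally real algebraic number `j`), no auxiliary field;
* TRBC `TotallyRealBaseChange` (bridge; WEAKER than REST_E; NEW typed functoriality leaf generalising g27's DBC (`F = ℚ`, Dieulefait)
  and NSBC (`2 ≤ [F:ℚ] ≤ 4`, `√5 ∉ F` if quartic) to every RESIDUAL degree `[F:ℚ] ≥ 5` or `= 4` with `√5 ∈ F`, `[F:ℚ] < [K₀:ℚ]`;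
  disjoint from g27's bridge range): base change INTO the box of the modularity of a j-primitive integral curve over a totally
  real field `F → K₀`.  Its solubly-covered locus is Langlands 1980 / Arthur–Clozel cyclic base change
  (PRINT, modulo the cofinite-trace ↔ Hecke-polynomial rendering of «modular»); its insoluble locus is base change of parallel-weight-2
  Hilbert newforms over `F ≠ ℚ` along non-solvable totally real extensions — in print only for `F = ℚ` (Dieulefait 2012/2015, safe
  chains), programme-level over real quadratic `F` and conjectural in general (Dieulefait–Pacetti, Rayuela Conjecture, modular
  variant Conj. 8.3 ⇒ base change for totally real fields) [ref: DieulefaitPacetti2015, pp. 219, 222 (LMS LN 420)];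
* finite/base range of the dial, BY NAME: the host rungs Q4 `EllipticDegreeLadder.QuarticModularity` (stmt 17832; `m = 4`, reached
  only through `InResidualRange`'s `√5`-quartic clause) and Q5 `EllipticDegreeLadder.QuinticModularity` (`m = 5`), the (A)-cell facts
  `Yoshikawa2019_theorem1_2` / `Thorne2019_thm1` (moduli field abelian with `3·5·7 ∤ disc`, or a cyclotomic `ℤ_p`-layer), and the
  lineage's own closed sectors AT THE FIELD OF MODULI (Allen door `allenDoorSector_of_corollary`, FLS generic / Skinner–Wiles /
  Pan–Zhang doors `modular_of_offDoors`);
* APB `AnchoredBPrimitiveModularity` (GLUE; S-implied; the declared PRICE of the descent, exactly as g29's F2T_B): j-primitive curves of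
  residual moduli degree over (B5)/(B7)-ANCHORED totally real fields of degree `≥ 6` (the field of moduli of a box curve may be anchored
  although `K₀` is not).  For a j-PRIMITIVE curve the host's anchor mechanism (items 26996/26997: a `15`- or `21`-stable odd solvable
  cover `F/F′`, `[F′:ℚ] ≤ 5`, places the moduli point in `F′`) contradicts primitivity outright — no base-range step is needed; typed,
  not claimed.

KERNEL (case analysis, no junction of its own): `modular_of_jPrimitive` — the pieces prove modularity of EVERY j-primitive integral
curve over EVERY totally real field of degree `≥ 4`; `core_of_pieces : ADC → FLS34 → SWD → PZD → Y19 → Th19 → Q4 → Q5 → APB → TRBC →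
PRIM → CORE`; EXACTNESS `prim_of_core : CORE → PRIM`, `trbc_of_restE : REST_E → TRBC`, `core_iff_prim`; compositions BY NAME
`residual_of_pieces` (RES), `largeJResidual_of_pieces` (LJR), `restE_of_pieces` (REST_E), `closes_target` / `closes_byName` (REST,
stmt-Langlands-26998, through the TREE `OddPrimeDoorSplit.closes_target`).  Inner cut of TRBC by the soluble-cover predicate
(`JDegreeFilterSplit.EmbedsInSolvableCover`, BY NAME): `trbc_iff_cover_split`.  0 sorry; axioms expected
[propext, Classical.choice, Quot.sound].

References (prose tags, cell census-twin convention): [ref: Dieulefait2015, Thm 1.2 (arXiv:1208.3946)] base change `ℚ → F`;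
[ref: DieulefaitPacetti2015, §8 (LMS Lecture Note Ser. 420, pp. 218–232)] Rayuela conjecture and base change over totally real
fields; [ref: Langlands1980AMS96, Ch. 2] cyclic base change; [ref: Thorne2016, Lemma 7.1, Thm 7.6] soluble base change for
elliptic curves, `X₀(15)` / `X(s3,b5)` descent; [ref: Box2022, Thm 1.3, Rem. 5.4]; [ref: FreitasLeHungSiksek2015, Thm 5].
-/

set_option linter.dupNamespace false
set_option linter.unusedVariables false

open scoped NumberField IntermediateField
open NumberField IsDedekindDomain Literature.NumberTheory.Automorphic
open Summit.Langlands.Langlands.Theorems.DepthIsolationSplit (UnanchoredBox UnanchoredHighDegreeModularE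
  modularE_iff_box IntegralModelTransferPointwise SatakeAvatarTwo satakeAvatarTwo_of_host)
open Summit.Langlands.Langlands.Theorems.JDegreeFilterSplit (jInv jDeg InResidualRange LargeJResidual
  RatBaseChangeModularity SmallFieldBaseChange EmbedsInSolvableCover jModel jModel_Δ_ne_zero jModel_c₄_pow_three_mul
  jInv_baseChange baseChange_Δ_ne_zero)
open Summit.Langlands.Langlands.Theorems.DyadicDoorSplit (AllenLocus AllenDyadicCorollary AllenDoorSector
  DyadicDegenerateResidual allenDoorSector_of_corollary)
open Summit.Langlands.Langlands.Theorems.TwoDivisionFieldSplit (ClauseA ClauseB5 ClauseB7 unanchoredBox_iff)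
open Summit.Langlands.Langlands.Theorems.OddPrimeDoorSplit (OffDoors CoreResidual SkinnerWilesDihedralDoor
  PanZhangSupersingularDoor modular_of_offDoors residual_of_core largeJResidual_of_core restE_of_core)
open Summit.Langlands.Langlands.Theorems.RealCyclotomicDoorSplit (BoxShape RefinedCore)
open Summit.Langlands.Langlands.Theses.EllipticDegreeLadder (QuarticModularity QuinticModularity)

namespace Summit.Langlands.Langlands.Theorems.ModuliFieldDescentSplit

/-! ## §4 KERNEL -/

/-- j-PRIMITIVE MODULARITY over EVERY totally real field of degree `≥ 4`, from the pieces: Q4 (`m = 4`), Q5 (`m = 5`); for `m ≥ 6`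
on a box field the lineage's closed sectors at that field (Allen door; generic / Skinner–Wiles / Pan–Zhang doors) and PRIM; on an
anchored field the (A)-cell facts and APB. -/
theorem modular_of_jPrimitive (hADC : AllenDyadicCorollary) (h34 : FLS2015_theorems3_4)
    (hSW : SkinnerWilesDihedralDoor) (hPZ : PanZhangSupersingularDoor) (hY : Yoshikawa2019_theorem1_2)
    (hTh : Thorne2019_thm1) (hQ4 : QuarticModularity) (hQ5 : QuinticModularity)
    (hAPB : AnchoredBPrimitiveModularity) (hP : PrimitiveCoreResidual)
    (F : Type) [Field F] [NumberField F] [IsTotallyReal F] (h4 : 4 ≤ Module.finrank ℚ F)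
    (E₀ : WeierstrassCurve (𝓞 F)) (hΔ₀ : E₀.Δ ≠ 0) (hprim : JPrimitive F E₀) : IsModularEllipticCurve F E₀ := by
  have hTR : IsTotallyReal F := inferInstance
  rcases (show Module.finrank ℚ F = 4 ∨ Module.finrank ℚ F = 5 ∨ 6 ≤ Module.finrank ℚ F by omega) with h | h | h6
  · exact hQ4 F hTR h E₀ hΔ₀
  · exact hQ5 F hTR h E₀ hΔ₀
  · have hr : InResidualRange F E₀ := Or.inl (by unfold JPrimitive at hprim; omega)
    by_cases hbox : UnanchoredBox F
    · by_cases hAl : AllenLocus F E₀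
      · exact allenDoorSector_of_corollary hADC F hbox E₀ hΔ₀ hr hAl
      · exact modular_of_offDoors h34 hSW hPZ F E₀ hΔ₀ (fun hoff => hP F hbox E₀ hΔ₀ hr hAl hoff hprim)
    · exact anchoredPrimitive_of_cells hY hTh hAPB F hTR (by omega) hbox E₀ hΔ₀ hr hprim

/-- KERNEL: the pieces give CORE.  A j-primitive core curve is PRIM's; an imprimitive one is, up to quadratic twist, the base change
(TRBC) of a j-primitive curve over its field of moduli `ℚ⟮j⟯` (degree `4 ≤ m < [K₀:ℚ]`), modular there by `modular_of_jPrimitive`. -/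
theorem core_of_pieces (hADC : AllenDyadicCorollary) (h34 : FLS2015_theorems3_4)
    (hSW : SkinnerWilesDihedralDoor) (hPZ : PanZhangSupersingularDoor) (hY : Yoshikawa2019_theorem1_2)
    (hTh : Thorne2019_thm1) (hQ4 : QuarticModularity) (hQ5 : QuinticModularity)
    (hAPB : AnchoredBPrimitiveModularity) (hBC : TotallyRealBaseChange) (hP : PrimitiveCoreResidual) :
    CoreResidual := by
  intro K₀ _ _ hbox E hΔ hr hA hoff
  haveI : IsTotallyReal K₀ := hbox.1
  by_cases hprim : JPrimitive K₀ E
  · exact hP K₀ hbox E hΔ hr hA hoff hprim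
  have hlt : Module.finrank ℚ ℚ⟮jInv K₀ E⟯ < Module.finrank ℚ K₀ :=
    finrank_moduliField_lt_of_not_jPrimitive K₀ E hprim
  have h4 : 4 ≤ Module.finrank ℚ ℚ⟮jInv K₀ E⟯ := four_le_jDeg_of_inResidualRange hr
  have hres : 5 ≤ Module.finrank ℚ ℚ⟮jInv K₀ E⟯ ∨
      (Module.finrank ℚ ℚ⟮jInv K₀ E⟯ = 4 ∧ IsSquare (5 : ℚ⟮jInv K₀ E⟯)) := hr
  refine isModularEllipticCurve_of_moduliField ℚ⟮jInv K₀ E⟯ K₀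
    ⟨jInv K₀ E, IntermediateField.mem_adjoin_simple_self ℚ _⟩ ?_ ?_ E hΔ rfl
  · intro E₀ hΔ₀ hj₀
    exact modular_of_jPrimitive hADC h34 hSW hPZ hY hTh hQ4 hQ5 hAPB hP ℚ⟮jInv K₀ E⟯ h4 E₀ hΔ₀
      (jPrimitive_over_moduliField K₀ E E₀ hj₀)
  · intro E₀ hΔ₀ hj₀ hmodF
    exact hBC K₀ hbox ℚ⟮jInv K₀ E⟯ hres hlt E₀ hΔ₀ (jPrimitive_over_moduliField K₀ E E₀ hj₀) hmodF

/-! ## §5 EXACTNESS -/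

/-- CORE ⟹ PRIM (PRIM is a sub-locus). -/
theorem prim_of_core (h : CoreResidual) : PrimitiveCoreResidual :=
  fun K₀ _ _ hb E hΔ hr hA hoff _ => h K₀ hb E hΔ hr hA hoff

/-- REST_E ⟹ TRBC (a base change into the box is an integral curve over a box field). -/
theorem trbc_of_restE (h : UnanchoredHighDegreeModularE) : TotallyRealBaseChange := by
  rw [modularE_iff_box] at h
  intro K₀ _ _ hbox F _ _ _ _ _ _ E₀ hΔ₀ _ _
  exact h K₀ hbox _ (baseChange_Δ_ne_zero F K₀ E₀ hΔ₀)

/-- EXACTNESS: modulo the junctions, the host rungs, APB and the bridge TRBC, CORE ⟺ PRIM. -/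
theorem core_iff_prim (hADC : AllenDyadicCorollary) (h34 : FLS2015_theorems3_4)
    (hSW : SkinnerWilesDihedralDoor) (hPZ : PanZhangSupersingularDoor) (hY : Yoshikawa2019_theorem1_2)
    (hTh : Thorne2019_thm1) (hQ4 : QuarticModularity) (hQ5 : QuinticModularity)
    (hAPB : AnchoredBPrimitiveModularity) (hBC : TotallyRealBaseChange) :
    CoreResidual ↔ PrimitiveCoreResidual :=
  ⟨prim_of_core, core_of_pieces hADC h34 hSW hPZ hY hTh hQ4 hQ5 hAPB hBC⟩

/-! ## §6 Compositions BY NAME to the lineage targets -/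

/-- RES (g28's residual) from the pieces, through the tree `OddPrimeDoorSplit.residual_of_core`. -/
theorem residual_of_pieces (hADC : AllenDyadicCorollary) (h34 : FLS2015_theorems3_4)
    (hSW : SkinnerWilesDihedralDoor) (hPZ : PanZhangSupersingularDoor) (hY : Yoshikawa2019_theorem1_2)
    (hTh : Thorne2019_thm1) (hQ4 : QuarticModularity) (hQ5 : QuinticModularity)
    (hAPB : AnchoredBPrimitiveModularity) (hBC : TotallyRealBaseChange) (hP : PrimitiveCoreResidual) :
    DyadicDegenerateResidual :=
  residual_of_core h34 hSW hPZ (core_of_pieces hADC h34 hSW hPZ hY hTh hQ4 hQ5 hAPB hBC hP)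

/-- LJR (g27's residual) from the pieces, through the tree `OddPrimeDoorSplit.largeJResidual_of_core`. -/
theorem largeJResidual_of_pieces (hADC : AllenDyadicCorollary) (h34 : FLS2015_theorems3_4)
    (hSW : SkinnerWilesDihedralDoor) (hPZ : PanZhangSupersingularDoor) (hY : Yoshikawa2019_theorem1_2)
    (hTh : Thorne2019_thm1) (hQ4 : QuarticModularity) (hQ5 : QuinticModularity)
    (hAPB : AnchoredBPrimitiveModularity) (hBC : TotallyRealBaseChange) (hP : PrimitiveCoreResidual) :
    LargeJResidual :=
  largeJResidual_of_core hADC h34 hSW hPZ (core_of_pieces hADC h34 hSW hPZ hY hTh hQ4 hQ5 hAPB hBC hP)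

/-- REST_E (g26's residual) from the pieces, through the tree `OddPrimeDoorSplit.restE_of_core`. -/
theorem restE_of_pieces (hDBC : RatBaseChangeModularity) (hNSBC : SmallFieldBaseChange)
    (hFLS : FLS2015_theorem1) (hDNS : DNS2020_theorem4) (hBox : Box2022_theorem1_1)
    (hADC : AllenDyadicCorollary) (h34 : FLS2015_theorems3_4)
    (hSW : SkinnerWilesDihedralDoor) (hPZ : PanZhangSupersingularDoor) (hY : Yoshikawa2019_theorem1_2)
    (hTh : Thorne2019_thm1) (hQ4 : QuarticModularity) (hQ5 : QuinticModularity)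
    (hAPB : AnchoredBPrimitiveModularity) (hBC : TotallyRealBaseChange) (hP : PrimitiveCoreResidual) :
    UnanchoredHighDegreeModularE :=
  restE_of_core hDBC hNSBC hFLS hDNS hBox hADC h34 hSW hPZ
    (core_of_pieces hADC h34 hSW hPZ hY hTh hQ4 hQ5 hAPB hBC hP)

/-- `closes_target`: the pieces and the lineage's junctions give REST = `TowerDoorSplit.UnanchoredHighDegreeWitnessAutomorphy`
(stmt-Langlands-26998) BY NAME, through the TREE `OddPrimeDoorSplit.closes_target` (g30's binder list with CORE replaced by the
eleven binders of `core_of_pieces`). -/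
theorem closes_target (hDBC : RatBaseChangeModularity) (hNSBC : SmallFieldBaseChange)
    (hFLS : FLS2015_theorem1) (hDNS : DNS2020_theorem4) (hBox : Box2022_theorem1_1)
    (hADC : AllenDyadicCorollary) (h34 : FLS2015_theorems3_4) (hSW : SkinnerWilesDihedralDoor)
    (hPZ : PanZhangSupersingularDoor) (hY : Yoshikawa2019_theorem1_2) (hTh : Thorne2019_thm1)
    (hQ4 : QuarticModularity) (hQ5 : QuinticModularity) (hAPB : AnchoredBPrimitiveModularity)
    (hBC : TotallyRealBaseChange) (hP : PrimitiveCoreResidual) (hIMT : IntegralModelTransferPointwise)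
    (hTr : Summit.Langlands.Langlands.Theses.EllipticDegreeLadder.EllipticTransportAnyBase)
    (hW : SatakeAvatarTwo)
    (h1 : Summit.Langlands.Langlands.Theses.EllipticDegreeLadder.RankOneAutomorphy) :
    Summit.Langlands.Langlands.Theses.TowerDoorSplit.UnanchoredHighDegreeWitnessAutomorphy :=
  Summit.Langlands.Langlands.Theorems.OddPrimeDoorSplit.closes_target hDBC hNSBC hFLS hDNS hBox hADC h34 hSW hPZ
    (core_of_pieces hADC h34 hSW hPZ hY hTh hQ4 hQ5 hAPB hBC hP) hIMT hTr hW h1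

/-- `closes_target` with W⁺ the host item `SatakeAvatarExistence` (stmt-Langlands-17415) BY NAME. -/
theorem closes_byName (hDBC : RatBaseChangeModularity) (hNSBC : SmallFieldBaseChange)
    (hFLS : FLS2015_theorem1) (hDNS : DNS2020_theorem4) (hBox : Box2022_theorem1_1)
    (hADC : AllenDyadicCorollary) (h34 : FLS2015_theorems3_4) (hSW : SkinnerWilesDihedralDoor)
    (hPZ : PanZhangSupersingularDoor) (hY : Yoshikawa2019_theorem1_2) (hTh : Thorne2019_thm1)
    (hQ4 : QuarticModularity) (hQ5 : QuinticModularity) (hAPB : AnchoredBPrimitiveModularity)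
    (hBC : TotallyRealBaseChange) (hP : PrimitiveCoreResidual) (hIMT : IntegralModelTransferPointwise)
    (hTr : Summit.Langlands.Langlands.Theses.EllipticDegreeLadder.EllipticTransportAnyBase)
    (hW : Summit.Langlands.Langlands.Theses.EllipticDegreeLadder.SatakeAvatarExistence)
    (h1 : Summit.Langlands.Langlands.Theses.EllipticDegreeLadder.RankOneAutomorphy) :
    Summit.Langlands.Langlands.Theses.TowerDoorSplit.UnanchoredHighDegreeWitnessAutomorphy :=
  closes_target hDBC hNSBC hFLS hDNS hBox hADC h34 hSW hPZ hY hTh hQ4 hQ5 hAPB hBC hP hIMT hTr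
    (satakeAvatarTwo_of_host hW) h1

/-! ## §7 Inside the bridge: solubly covered (PRINT) versus insolubly covered (IDEA-NEEDED) base change -/

/-- TRBC_sol (PRINT modulo the rendering of «modular»: Langlands 1980 cyclic base change along a composition series of the
relative solvable Galois closure, cuspidality kept because `M` is totally real and the curve non-CM; CM is the first
alternative of the predicate): TRBC on the pairs `F → K₀` SOLUBLY covered (`EmbedsInSolvableCover`, g27 BY NAME). -/
def TotallyRealBaseChangeSoluble : Prop :=
  ∀ (K₀ : Type) [Field K₀] [NumberField K₀], UnanchoredBox K₀ →
    ∀ (F : Type) [Field F] [NumberField F] [IsTotallyReal F] [Algebra F K₀],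
      (5 ≤ Module.finrank ℚ F ∨ (Module.finrank ℚ F = 4 ∧ IsSquare (5 : F))) → Module.finrank ℚ F < Module.finrank ℚ K₀ → EmbedsInSolvableCover F K₀ →
      ∀ E₀ : WeierstrassCurve (𝓞 F), E₀.Δ ≠ 0 → JPrimitive F E₀ → IsModularEllipticCurve F E₀ →
        IsModularEllipticCurve K₀ (E₀.baseChange (𝓞 K₀))

/-- TRBC_ins (IDEA-NEEDED; the honest open core of the bridge: NON-SOLVABLE base change of parallel-weight-2 Hilbert newforms with
rational Hecke field over a totally real `F` of degree `≥ 4`; first instances `[K₀:F] ≥ 5` with relative closure `A₅ / S₅`). -/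
def TotallyRealBaseChangeInsoluble : Prop :=
  ∀ (K₀ : Type) [Field K₀] [NumberField K₀], UnanchoredBox K₀ →
    ∀ (F : Type) [Field F] [NumberField F] [IsTotallyReal F] [Algebra F K₀],
      (5 ≤ Module.finrank ℚ F ∨ (Module.finrank ℚ F = 4 ∧ IsSquare (5 : F))) → Module.finrank ℚ F < Module.finrank ℚ K₀ → ¬ EmbedsInSolvableCover F K₀ →
      ∀ E₀ : WeierstrassCurve (𝓞 F), E₀.Δ ≠ 0 → JPrimitive F E₀ → IsModularEllipticCurve F E₀ →
        IsModularEllipticCurve K₀ (E₀.baseChange (𝓞 K₀))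

/-- EXACTNESS of the inner cut (excluded middle on the cover predicate). -/
theorem trbc_iff_cover_split :
    TotallyRealBaseChange ↔ TotallyRealBaseChangeSoluble ∧ TotallyRealBaseChangeInsoluble := by
  refine ⟨fun h => ⟨fun K₀ _ _ hb F _ _ _ _ h4 hlt _ E₀ hΔ₀ hp hm => h K₀ hb F h4 hlt E₀ hΔ₀ hp hm,
    fun K₀ _ _ hb F _ _ _ _ h4 hlt _ E₀ hΔ₀ hp hm => h K₀ hb F h4 hlt E₀ hΔ₀ hp hm⟩, ?_⟩
  rintro ⟨hs, hi⟩ K₀ _ _ hb F _ _ _ _ h4 hlt E₀ hΔ₀ hp hm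
  by_cases hc : EmbedsInSolvableCover F K₀
  · exact hs K₀ hb F h4 hlt hc E₀ hΔ₀ hp hm
  · exact hi K₀ hb F h4 hlt hc E₀ hΔ₀ hp hm

/-! ## §8 Joint refinement with g31's Box-shape carve (the two cuts COMMUTE) -/

/-- PRIM′ (PRIM ∩ CORE′ of g31, BY NAME `RealCyclotomicDoorSplit.BoxShape`): the j-PRIMITIVE core curves WITH Box's residual
image shape (clause (i) at `3`; Borel at `5` if `√5 ∉ K₀`; Borel or `G(e7)` at `7` if `ℚ(ζ₇)⁺ ⊄ K₀`).  In moduli terms: closed points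
`x` of the four level-`105` curves of Box 2022 Thm 1.2 with `ℚ(x) = ℚ(j(x))` totally real unanchored of degree `≥ 6`. -/
def PrimitiveRefinedCore : Prop :=
  ∀ (K₀ : Type) [Field K₀] [NumberField K₀], UnanchoredBox K₀ →
    ∀ E : WeierstrassCurve (𝓞 K₀), E.Δ ≠ 0 → InResidualRange K₀ E → ¬ AllenLocus K₀ E → OffDoors K₀ E →
      BoxShape K₀ E → JPrimitive K₀ E → IsModularEllipticCurve K₀ E

/-- PRIM ⟸ BOX13 ∧ PRIM′ (g31's pointwise argument: a non-automorphic curve has Box shape by `Box2022_theorem1_3`, an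
automorphic one is modular by the PROVED bridge `IsHilbertModular.of_isAutomorphicOfWeightZero`). -/
theorem prim_of_box13 (hB : Box2022_theorem1_3) (hR : PrimitiveRefinedCore) : PrimitiveCoreResidual := by
  intro K₀ _ _ hb E hΔ hr hA hoff hprim
  haveI : IsTotallyReal K₀ := hb.1
  by_cases hmod : IsAutomorphicOfWeightZero E
  · exact (IsHilbertModular.of_isAutomorphicOfWeightZero hΔ hmod).isModularEllipticCurve
  · exact hR K₀ hb E hΔ hr hA hoff (hB K₀ E hΔ hmod) hprim

/-- PRIM′ ⟸ CORE′ (sub-locus) — so PRIM′ sits below BOTH g31's CORE′ and this node's PRIM. -/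
theorem primRefined_of_refined (h : RefinedCore) : PrimitiveRefinedCore :=
  fun K₀ _ _ hb E hΔ hr hA hoff hS _ => h K₀ hb E hΔ hr hA hoff hS

/-- PRIM′ ⟸ PRIM (sub-locus). -/
theorem primRefined_of_prim (h : PrimitiveCoreResidual) : PrimitiveRefinedCore :=
  fun K₀ _ _ hb E hΔ hr hA hoff _ hprim => h K₀ hb E hΔ hr hA hoff hprim

/-- JOINT KERNEL: CORE ⟸ junctions ∧ Q4 ∧ Q5 ∧ APB ∧ TRBC ∧ BOX13 ∧ PRIM′. -/
theorem core_of_joint_pieces (hADC : AllenDyadicCorollary) (h34 : FLS2015_theorems3_4)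
    (hSW : SkinnerWilesDihedralDoor) (hPZ : PanZhangSupersingularDoor) (hY : Yoshikawa2019_theorem1_2)
    (hTh : Thorne2019_thm1) (hQ4 : QuarticModularity) (hQ5 : QuinticModularity)
    (hAPB : AnchoredBPrimitiveModularity) (hBC : TotallyRealBaseChange) (hB : Box2022_theorem1_3)
    (hR : PrimitiveRefinedCore) : CoreResidual :=
  core_of_pieces hADC h34 hSW hPZ hY hTh hQ4 hQ5 hAPB hBC (prim_of_box13 hB hR)

/-! ## §9 Guards (the dial is a genuine cut: both cells are inhabited shapes, neither is CORE by restriction of the other) -/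

/-- PRIM is CORE with ONE extra hypothesis (the converse `PRIM → CORE` is the content of TRBC ∧ lower-degree modularity). -/
theorem prim_binder_shape :
    PrimitiveCoreResidual ↔
      ∀ (K₀ : Type) [Field K₀] [NumberField K₀], UnanchoredBox K₀ →
        ∀ E : WeierstrassCurve (𝓞 K₀), E.Δ ≠ 0 → InResidualRange K₀ E → ¬ AllenLocus K₀ E → OffDoors K₀ E →
          jDeg K₀ E = Module.finrank ℚ K₀ → IsModularEllipticCurve K₀ E :=
  Iff.rfl

end Summit.Langlands.Langlands.Theorems.ModuliFieldDescentSplit
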